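import Literature.Analysis.FluidPDE.NSCoriolisTorusReduction
import HarnessLib

/-!
# Babin–Mahalov–Nicolaenko ⇐ the `Ω`-uniform enstrophy bound on the initial layer and the
# continuation principle for classical solutions on `𝕋³` (fact split)

Topic `Analysis/FluidPDE`. Fact-decomposition file (librarian, mode `fact-decompose`, 2026-08-16)
for the named fact `Literature.Analysis.FluidPDE.bmn1999_rotating_ns_global_regularity`
(`NSCoriolis.lean`; A. Babin, A. Mahalov, B. Nicolaenko, *Global regularity of 3D rotating
Navier–Stokes equations for resonant domains*, Indiana Univ. Math. J. 48 (1999) 1133–1176,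
Thm. 1.1 = Thm. 5.3, rendered for unit periods, `F = 0`, `α = 1`, smooth data).

The tree has PROVED: the reduction of the `ℤ³`-periodic statement to its torus form
(`bmn1999_rotating_ns_global_regularity_of_torus`, `NSCoriolisTorusReduction.lean`); that the
enstrophy balance of the rotating system carries no `Ω` and the resulting `Ω`-UNIFORM local `H¹`
control, the good times of (5.41)–(5.42), small-enstrophy global control and "global control =
control of the initial layer" (`NSCoriolisEnstrophy.lean`, `NSCoriolisGoodTimes.lean`,
`NSCoriolisH1Apriori.lean`: `torus_gradNormSq_le_max_of_layer`); gluing and uniqueness of periodic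
classical solutions of the rotating system (`NSCoriolisGluing.lean`, `NSCoriolisUniqueness.lean`).
What is NOT in the tree is (a) BMN's theorem proper — the `H¹` bound on the initial layer
`[0, T⋆]` for large data once `Ω ≥ Ω₁(M, ν)` (resonances of the Poincaré–Coriolis propagator,
the limit "2½-dimensional" equations, small divisors: §§3–5 of the paper) — and (b) the local
existence / continuation theory of classical solutions on `𝕋³`.

This file NAMES these two inputs in the torus vocabulary of `…_of_torus` and records the PROVED
assembly (modus ponens):

* `bmn1999_torus_enstrophy_apriori_bound` — **(a), a priori form of Thm. 5.2 / proof of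
  Thm. 5.3**: for `ν > 0`, `M` there are `Ω₁`, `M'` such that for `Ω ≥ Ω₁` EVERY classical
  solution of the rotating system on `𝕋³ × [0, b]` (`b > 0`) with mean-zero initial value of
  enstrophy `‖∇u(0)‖₂² ≤ M²` obeys `‖∇u(t)‖₂² ≤ M'²` on `[0, b]` (uniqueness of classical solutions
  makes "every" harmless; with `torus_gradNormSq_le_max_of_layer` only the layer `[0, T⋆(M, ν)]`
  is genuinely at stake).
* `torus_rotating_ns_global_of_enstrophy_apriori_bound` — **(b), the continuation principle**:
  if such an a priori bound holds for given `ν, Ω, M, M'`, then every smooth divergence-free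
  mean-zero datum with `‖∇u₀‖₂² ≤ M²` launches a GLOBAL classical solution of the rotating system
  on `𝕋³ × [0, ∞)` obeying the bound (Leray; Robinson–Rodrigo–Sadowski 2016, Thm. 6.8: local
  strong solutions on `𝕋³` on `[0, c‖∇u₀‖⁻⁴]`; Lemma 6.11: `‖∇u‖` blows up at a finite maximal
  time; Thm. 7.5: strong solutions are smooth — the skew, zero-order Coriolis term changes none
  of the energy-method proofs, BMN p. 1140 and §5, "`T_α` independent of `Ω`").
* `bmn1999_rotating_ns_global_regularity_holds_of` — PROVED: (a) and (b) give the torus form,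
  hence the fact (`…_of_torus`).

Neither child restates the parent: (a) is an a priori estimate quantified over solutions on
compact time intervals (no existence), (b) is an `Ω`-by-`Ω` conditional existence statement with
the estimate as hypothesis (no fast-rotation content).

## References

* A. Babin, A. Mahalov, B. Nicolaenko, Indiana Univ. Math. J. 48 (1999) 1133–1176: §2 p. 1140,
  §5, Thms. 5.1–5.3, (5.41)–(5.48), pp. 1170–1171. [BabinMahalovNicolaenko1999]
* J. C. Robinson, J. L. Rodrigo, W. Sadowski, *The Three-Dimensional Navier–Stokes Equations.
  Classical Theory*, CUP 2016: Thm. 6.8, Lemma 6.11, Thm. 7.5, §8.1.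
  [RobinsonRodrigoSadowskiCUP2016]
-/

noncomputable section

open MeasureTheory Set Function
open scoped ContDiff InnerProductSpace RealInnerProductSpace

namespace Literature.Analysis.FluidPDE

/-- **Babin–Mahalov–Nicolaenko 1999, the `Ω`-uniform enstrophy bound (Thm. 5.2 and the proof of
Thm. 5.3, `α = 1`, `F = 0`, unit periods), a priori form on the torus.** For every `ν > 0` and
`M` there are `Ω₁` and `M'` such that for every `Ω ≥ Ω₁`, every `b > 0` and every classical
solution `(u, p)` on `𝕋³ × [0, b]` of the Navier–Stokes system with viscosity `ν` forced by
`−Ω e₃ × u` (the rotating system (1.1) read on the torus, as in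
`bmn1999_rotating_ns_global_regularity_of_torus`) whose initial value has zero mean and
`‖∇u(0)‖²_{L²(𝕋³)} ≤ M²`: `‖∇u(t)‖²_{L²(𝕋³)} ≤ M'²` for all `t ∈ [0, b]`.  Printed: Thm. 1.1 /
5.3, "`‖U(t)‖_α ≤ M'_α` for all `t ≥ 0`" for `Ω ≥ Ω₁(M_α, ν, a)`, obtained in §5 as a bound valid
on every interval of regularity (Thm. 5.1–5.2: the error between `U` and the solution of the
limit resonant equations is small for `Ω` large on `[0, T_α]`, `T_α` independent of `Ω`; then
restart at good times, (5.41)–(5.48)).  In the tree the passage "layer bound ⇒ bound on all of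
`[0, b]`" is proved (`IsClassicalNSCoriolisSolutionOn.torus_gradNormSq_le_max_of_layer`), so the
content of this fact is the bound on the initial layer `[0, T⋆(M, ν)]`; uniqueness of classical
solutions (`NSCoriolisUniqueness.lean`) identifies "every classical solution" with BMN's.
[cite: BabinMahalovNicolaenko1999, Thm. 5.2 and proof of Thm. 5.3 (pp. 1170–1171), with §2 p. 1140] -/
def bmn1999_torus_enstrophy_apriori_bound : Prop :=
  ∀ ν : ℝ, 0 < ν → ∀ M : ℝ, ∃ Ω₁ M' : ℝ, ∀ Ω : ℝ, Ω₁ ≤ Ω → ∀ b : ℝ, 0 < b →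
    ∀ (u : ℝ → UnitAddTorus (Fin 3) → EuclideanSpace ℝ (Fin 3))
      (p : ℝ → UnitAddTorus (Fin 3) → ℝ),
      FunctionSpaces.Torus.IsClassicalNSSolutionOn (Icc 0 b) ν
          (fun t x => -coriolisForce Ω (u t x)) u p →
        FunctionSpaces.Torus.HasZeroMean (u 0) →
        FunctionSpaces.Torus.gradNormSq (u 0) ≤ M ^ 2 →
        ∀ t ∈ Icc 0 b, FunctionSpaces.Torus.gradNormSq (u t) ≤ M' ^ 2

/-- **Continuation principle for the rotating Navier–Stokes system on `𝕋³`: an a priori enstrophy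
bound yields global classical solutions.** Fix `ν > 0`, `Ω`, `M`, `M'`. IF every classical
solution of the rotating system on `𝕋³ × [0, b]` (`b > 0`) with mean-zero initial value of
enstrophy `≤ M²` has enstrophy `≤ M'²` on `[0, b]`, THEN every smooth, divergence-free, mean-zero
`u₀` with `‖∇u₀‖₂² ≤ M²` admits a classical solution `(u, p)` of the rotating system on
`𝕋³ × [0, ∞)` with `u(0) = u₀` and `‖∇u(t)‖₂² ≤ M'²` for all `t ≥ 0`.  Printed ingredients
(for Navier–Stokes on `𝕋³`; the skew zero-order term `−Ω e₃ × u` is invisible to the energy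
method, BMN p. 1140): local strong solutions from `H¹` data on `[0, c‖∇u₀‖⁻⁴]` (RRS Thm. 6.8,
Leray / Kiselev–Ladyzhenskaya), smoothness of strong solutions — on the torus with smooth data up
to `t = 0` (RRS Thm. 7.5 and the remark following it), and the blow-up alternative: at a finite
maximal time `‖∇u(t)‖` is unbounded (RRS Lemma 6.11); an a priori bound on every `[0, b]` thus
forces the maximal time to be `∞`, and gluing the local pieces (tree: `NSCoriolisGluing.lean`,
`NSCoriolisUniqueness.lean`) gives the global classical solution.
[cite: RobinsonRodrigoSadowskiCUP2016, Thm. 6.8, Lemma 6.11 and Thm. 7.5]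
[cite: BabinMahalovNicolaenko1999, §2 p. 1140 and proof of Thm. 5.3 (pp. 1170–1171)] -/
def torus_rotating_ns_global_of_enstrophy_apriori_bound : Prop :=
  ∀ ν : ℝ, 0 < ν → ∀ (Ω M M' : ℝ),
    (∀ b : ℝ, 0 < b →
      ∀ (u : ℝ → UnitAddTorus (Fin 3) → EuclideanSpace ℝ (Fin 3))
        (p : ℝ → UnitAddTorus (Fin 3) → ℝ),
        FunctionSpaces.Torus.IsClassicalNSSolutionOn (Icc 0 b) ν
            (fun t x => -coriolisForce Ω (u t x)) u p →
          FunctionSpaces.Torus.HasZeroMean (u 0) →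
          FunctionSpaces.Torus.gradNormSq (u 0) ≤ M ^ 2 →
          ∀ t ∈ Icc 0 b, FunctionSpaces.Torus.gradNormSq (u t) ≤ M' ^ 2) →
    ∀ u₀ : UnitAddTorus (Fin 3) → EuclideanSpace ℝ (Fin 3),
      FunctionSpaces.Torus.IsSmooth u₀ → FunctionSpaces.Torus.IsDivFree u₀ →
      FunctionSpaces.Torus.HasZeroMean u₀ → FunctionSpaces.Torus.gradNormSq u₀ ≤ M ^ 2 →
      ∃ (u : ℝ → UnitAddTorus (Fin 3) → EuclideanSpace ℝ (Fin 3))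
        (p : ℝ → UnitAddTorus (Fin 3) → ℝ),
        FunctionSpaces.Torus.IsClassicalNSSolutionOn (Ici 0) ν
            (fun t x => -coriolisForce Ω (u t x)) u p ∧
          u 0 = u₀ ∧ ∀ t : ℝ, 0 ≤ t → FunctionSpaces.Torus.gradNormSq (u t) ≤ M' ^ 2

/-- **Assembly (fact split): Babin–Mahalov–Nicolaenko's theorem from the `Ω`-uniform a priori
bound and the continuation principle** — modus ponens into the torus form, then the tree's
`bmn1999_rotating_ns_global_regularity_of_torus`.
[cite: BabinMahalovNicolaenko1999, Thm. 1.1 (= Thm. 5.3)] -/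
theorem bmn1999_rotating_ns_global_regularity_holds_of
    (hA : bmn1999_torus_enstrophy_apriori_bound)
    (hB : torus_rotating_ns_global_of_enstrophy_apriori_bound) :
    bmn1999_rotating_ns_global_regularity := by
  refine bmn1999_rotating_ns_global_regularity_of_torus fun ν hν M => ?_
  obtain ⟨Ω₁, M', hΩ⟩ := hA ν hν M
  exact ⟨Ω₁, M', fun Ω hΩle u₀ hsm hdiv hmean hgrad =>
    hB ν hν Ω M M' (hΩ Ω hΩle) u₀ hsm hdiv hmean hgrad⟩

end Literature.Analysis.FluidPDE

end
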